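import Summits.RiemannHypothesis.RiemannHypothesis.Theorems.TiltedLandingLaw421R3Lens1ArcSignF

/-!
# TiltedLandingLaw421R3 — lens-1: the EXACT word identity of a loop (part G: `2·wind Γ = σ(½) − σ(0) + 4(#desc − #asc)`)

LENS-1 gen-6 module image `rh33346-cover/lens-1/ArcSignG-v1.lean` (landing target `…/Theorems/TiltedLandingLaw421R3Lens1ArcSignG.lean`; single import =
part F; namespace `RhW08.Lens1ArcSign`; 0 `sorry`, no instances / notation; checked BY CHAIN over the ArcSign A–F images until tree).

Part D proved the potential INEQUALITY (no ascending piece ⇒ surplus `n ≥ 0`).  Here the same strong induction along the finitely many real points of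
the upper half `[0, ½]` of a loop `Γ` is run with EQUALITY and a signed count (memo O6d §1 (WORD)):
  `Im (l(½) − l(0)) = (π/2)(σ(½) − σ(0)) + 2π(#desc − #asc)`,
where `#asc` / `#desc` (`ascSet Γ`, `descSet Γ` — generic in `Γ`; for `Γ = arcPhi f j a δ` they ARE part Fʼs `ascStarts` / `descStarts`, by `rfl`) count
the bad pieces between CONSECUTIVE real points of `Γ` that go from `Re Γ < 0` to `Re Γ > 0` / the other way.  For a conjugation-symmetric zero-free
loop this gives `2·wind Γ = sgn Re Γ(½) − sgn Re Γ(0) + 4(#desc − #asc)` exactly (`two_mul_wind_eq_count`; the flat case has no pieces).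

CONTENT: §1 `ascSet`, `descSet`, `ascStarts_eq_ascSet`, `descStarts_eq_descSet`, `ascSet_subset`, `descSet_subset` · §2 `card_filter_le_step` ·
§3 ★ `im_incr_eq_count` · §4 ★ `two_mul_wind_eq_count`.  Part H turns it into the disc census with count and proves RUNG 3 and the CONVERSION.

HONEST LABEL: loop bookkeeping only; `PinningOfNetNonAscending` / `PinningOfArcCount` are proved in part H; `TopPinning`, 33346, 33347 OPEN; nothing
here bears on the truth of RH; RH is not proved; checked ≠ proved.
-/

noncomputable section

namespace RhW08.Lens1ArcSign

open Complex Set Metric Filter Topology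
open scoped Real
open Literature.Topology.PlaneTopology Literature.Analysis.Complex
open Summit.RiemannHypothesis.RiemannHypothesis.Theorems.Splittings.JensenWindow

/-! ## §1 Ascending / descending pieces of a loop -/

/-- Earlier end points of the ASCENDING bad pieces of the upper half of a loop `Γ` (generic form of part Fʼs `ascStarts`). -/
def ascSet (Γ : ℝ → ℂ) : Set ℝ :=
  {t₁ | ∃ t₂, (0 ≤ t₁ ∧ t₁ < t₂ ∧ t₂ ≤ 1 / 2 ∧ (∀ t ∈ Ioo t₁ t₂, 0 < (Γ t).im) ∧ (Γ t₁).im = 0 ∧ (Γ t₂).im = 0) ∧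
    (Γ t₁).re < 0 ∧ 0 < (Γ t₂).re}

/-- Earlier end points of the DESCENDING bad pieces of the upper half of a loop `Γ`. -/
def descSet (Γ : ℝ → ℂ) : Set ℝ :=
  {t₁ | ∃ t₂, (0 ≤ t₁ ∧ t₁ < t₂ ∧ t₂ ≤ 1 / 2 ∧ (∀ t ∈ Ioo t₁ t₂, 0 < (Γ t).im) ∧ (Γ t₁).im = 0 ∧ (Γ t₂).im = 0) ∧
    0 < (Γ t₁).re ∧ (Γ t₂).re < 0}

/-- Part Fʼs `ascStarts` is `ascSet` of `arcPhi` (definitionally). -/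
theorem ascStarts_eq_ascSet (f : ℂ → ℂ) (j : ℕ) (a : ℂ) (δ : ℝ) : ascStarts f j a δ = ascSet (arcPhi f j a δ) := rfl

/-- Part Fʼs `descStarts` is `descSet` of `arcPhi` (definitionally). -/
theorem descStarts_eq_descSet (f : ℂ → ℂ) (j : ℕ) (a : ℂ) (δ : ℝ) : descStarts f j a δ = descSet (arcPhi f j a δ) := rfl

/-- Ascending starts are real points of `Γ` in `[0, ½]`. -/
theorem ascSet_subset (Γ : ℝ → ℂ) : ascSet Γ ⊆ {t : ℝ | t ∈ Icc (0 : ℝ) (1 / 2) ∧ (Γ t).im = 0} := by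
  rintro t₁ ⟨t₂, ⟨h₁, h12, h₂, -, him, -⟩, -, -⟩
  exact ⟨⟨h₁, by linarith⟩, him⟩

/-- Descending starts are real points of `Γ` in `[0, ½]`. -/
theorem descSet_subset (Γ : ℝ → ℂ) : descSet Γ ⊆ {t : ℝ | t ∈ Icc (0 : ℝ) (1 / 2) ∧ (Γ t).im = 0} := by
  rintro t₁ ⟨t₂, ⟨h₁, h12, h₂, -, him, -⟩, -, -⟩
  exact ⟨⟨h₁, by linarith⟩, him⟩

/-! ## §2 Counting along consecutive points -/

/-- One step of the count along a finite set `Z ⊇ S`: if `t'` is the first point of `Z` after `t`, the members of `S` from `t` on are those from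
`t'` on, plus `t` itself when `t ∈ S`. -/
theorem card_filter_le_step {S Z : Finset ℝ} (hSZ : S ⊆ Z) {t t' : ℝ} (htt' : t < t') (hmin : ∀ s ∈ Z, t < s → t' ≤ s) :
    ((S.filter (fun u => t ≤ u)).card : ℝ) = (S.filter (fun u => t' ≤ u)).card + (if t ∈ S then 1 else 0) := by
  classical
  by_cases ht : t ∈ S
  · have e : S.filter (fun u => t ≤ u) = insert t (S.filter (fun u => t' ≤ u)) := by
      ext u
      simp only [Finset.mem_filter, Finset.mem_insert]
      constructor
      · rintro ⟨huS, htu⟩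
        rcases htu.eq_or_lt with h | h
        · exact Or.inl h.symm
        · exact Or.inr ⟨huS, hmin u (hSZ huS) h⟩
      · rintro (rfl | ⟨huS, h⟩)
        · exact ⟨ht, le_rfl⟩
        · exact ⟨huS, htt'.le.trans h⟩
    have hnot : t ∉ S.filter (fun u => t' ≤ u) := by
      simp only [Finset.mem_filter, not_and, not_le]
      exact fun _ => htt'
    rw [e, Finset.card_insert_of_notMem hnot, if_pos ht]
    push_cast; ring
  · have e : S.filter (fun u => t ≤ u) = S.filter (fun u => t' ≤ u) := by
      ext u
      simp only [Finset.mem_filter]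
      constructor
      · rintro ⟨huS, htu⟩
        have hneq : t ≠ u := fun h => ht (h ▸ huS)
        exact ⟨huS, hmin u (hSZ huS) (lt_of_le_of_ne htu hneq)⟩
      · rintro ⟨huS, h⟩
        exact ⟨huS, htt'.le.trans h⟩
    rw [e, if_neg ht, add_zero]

/-! ## §3 The exact potential identity -/

/-- ★ EXACT WORD IDENTITY (partition form of `two_mul_wind_eq`, with equality).  `Γ` continuous and zero-free on `[0, ½]` with real ends and
finitely many real points, `l` a continuous logarithm ⇒ `Im (l(½) − l(0)) = (π/2)(σ(½) − σ(0)) + 2π(#desc − #asc)`, both counts finite. -/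
theorem im_incr_eq_count {Γ l : ℝ → ℂ} (hΓ : ContinuousOn Γ (Icc 0 (1 / 2))) (hl : ContinuousOn l (Icc 0 (1 / 2)))
    (hexp : ∀ t ∈ Icc (0 : ℝ) (1 / 2), exp (l t) = Γ t) (hne : ∀ t ∈ Icc (0 : ℝ) (1 / 2), Γ t ≠ 0)
    (h0 : (Γ 0).im = 0) (hh : (Γ (1 / 2)).im = 0) (hfin : {t : ℝ | t ∈ Icc (0 : ℝ) (1 / 2) ∧ (Γ t).im = 0}.Finite) :
    (ascSet Γ).Finite ∧ (descSet Γ).Finite ∧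
      (l (1 / 2)).im - (l 0).im = π / 2 * ((zsgn (Γ (1 / 2)).re : ℝ) - (zsgn (Γ 0).re : ℝ)) +
        2 * π * (((descSet Γ).ncard : ℝ) - ((ascSet Γ).ncard : ℝ)) := by
  classical
  have hAfin : (ascSet Γ).Finite := hfin.subset (ascSet_subset Γ)
  have hDfin : (descSet Γ).Finite := hfin.subset (descSet_subset Γ)
  refine ⟨hAfin, hDfin, ?_⟩
  set Z : Finset ℝ := hfin.toFinset with hZ
  have hmemZ : ∀ t, t ∈ Z ↔ t ∈ Icc (0 : ℝ) (1 / 2) ∧ (Γ t).im = 0 := fun t => by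
    rw [hZ, Set.Finite.mem_toFinset]; rfl
  set A : Finset ℝ := hAfin.toFinset with hA
  set D : Finset ℝ := hDfin.toFinset with hD
  have hmemA : ∀ t, t ∈ A ↔ t ∈ ascSet Γ := fun t => by rw [hA, Set.Finite.mem_toFinset]
  have hmemD : ∀ t, t ∈ D ↔ t ∈ descSet Γ := fun t => by rw [hD, Set.Finite.mem_toFinset]
  have hAZ : A ⊆ Z := fun t ht => (hmemZ t).2 (ascSet_subset Γ ((hmemA t).1 ht))
  have hDZ : D ⊆ Z := fun t ht => (hmemZ t).2 (descSet_subset Γ ((hmemD t).1 ht))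
  have hcardA : ((ascSet Γ).ncard : ℝ) = (A.filter (fun u => (0 : ℝ) ≤ u)).card := by
    have e : A.filter (fun u => (0 : ℝ) ≤ u) = A := Finset.filter_true_of_mem fun u hu => ((hmemZ u).1 (hAZ hu)).1.1
    rw [e, hA, ← Set.ncard_eq_toFinset_card _ hAfin]
  have hcardD : ((descSet Γ).ncard : ℝ) = (D.filter (fun u => (0 : ℝ) ≤ u)).card := by
    have e : D.filter (fun u => (0 : ℝ) ≤ u) = D := Finset.filter_true_of_mem fun u hu => ((hmemZ u).1 (hDZ hu)).1.1
    rw [e, hD, ← Set.ncard_eq_toFinset_card _ hDfin]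
  have hhalf : (1 / 2 : ℝ) ∈ Z := (hmemZ _).2 ⟨⟨by norm_num, le_rfl⟩, hh⟩
  have hzero : (0 : ℝ) ∈ Z := (hmemZ _).2 ⟨⟨le_rfl, by norm_num⟩, h0⟩
  suffices H : ∀ n : ℕ, ∀ t ∈ Z, (Z.filter (fun s => t < s)).card = n →
      (l (1 / 2)).im - (l t).im = π / 2 * ((zsgn (Γ (1 / 2)).re : ℝ) - (zsgn (Γ t).re : ℝ)) +
        2 * π * (((D.filter (fun u => t ≤ u)).card : ℝ) - ((A.filter (fun u => t ≤ u)).card : ℝ)) by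
    rw [hcardA, hcardD]; exact H _ 0 hzero rfl
  intro n
  induction n using Nat.strong_induction_on with
  | _ n ih =>
  intro t ht hcard
  obtain ⟨⟨ht0, hth⟩, htim⟩ := (hmemZ t).1 ht
  -- no piece starts at or after `½`
  have hlate : ∀ S : Finset ℝ, (∀ u, u ∈ S ↔ u ∈ ascSet Γ) ∨ (∀ u, u ∈ S ↔ u ∈ descSet Γ) →
      S.filter (fun u => (1 / 2 : ℝ) ≤ u) = ∅ := by
    intro S hS
    refine Finset.filter_false_of_mem fun u hu => ?_
    rcases hS with hS | hS
    · obtain ⟨t₂, ⟨-, h12, h₂, -⟩, -⟩ := (hS u).1 hu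
      push Not; linarith
    · obtain ⟨t₂, ⟨-, h12, h₂, -⟩, -⟩ := (hS u).1 hu
      push Not; linarith
  rcases hth.eq_or_lt with rfl | hlt
  · rw [hlate A (Or.inl hmemA), hlate D (Or.inr hmemD)]
    simp
  have hne' : (Z.filter (fun s => t < s)).Nonempty := ⟨1 / 2, Finset.mem_filter.2 ⟨hhalf, hlt⟩⟩
  obtain ⟨ht'Z, htt'⟩ := Finset.mem_filter.1 (Finset.min'_mem _ hne')
  set t' : ℝ := (Z.filter (fun s => t < s)).min' hne' with ht'
  obtain ⟨⟨-, ht'h⟩, ht'im⟩ := (hmemZ t').1 ht'Z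
  have hmin : ∀ s ∈ Z, t < s → t' ≤ s := fun s hs hts => Finset.min'_le _ _ (Finset.mem_filter.2 ⟨hs, hts⟩)
  have hsub : Icc t t' ⊆ Icc (0 : ℝ) (1 / 2) := Icc_subset_Icc ht0 ht'h
  have hgap : ∀ s ∈ Ioo t t', (Γ s).im ≠ 0 := by
    intro s hs h0s
    have hsZ : s ∈ Z := (hmemZ s).2 ⟨⟨ht0.trans hs.1.le, hs.2.le.trans ht'h⟩, h0s⟩
    exact absurd (hmin s hsZ hs.1) (not_le.2 hs.2)
  have hcard' : (Z.filter (fun s => t' < s)).card < n := by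
    rw [← hcard]
    refine Finset.card_lt_card ⟨fun s hs => ?_, fun hss => ?_⟩
    · obtain ⟨hsZ, hs⟩ := Finset.mem_filter.1 hs
      exact Finset.mem_filter.2 ⟨hsZ, htt'.trans hs⟩
    · exact lt_irrefl _ (Finset.mem_filter.1 (hss (Finset.min'_mem _ hne'))).2
  have IH := ih _ hcard' t' ht'Z rfl
  have hstepA := card_filter_le_step hAZ htt' hmin
  have hstepD := card_filter_le_step hDZ htt' hmin
  have hret : (Γ t).re ≠ 0 := fun h => hne t ⟨ht0, hth⟩ (Complex.ext (by simpa using h) (by simpa using htim))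
  have hret' : (Γ t').re ≠ 0 := fun h => hne t' ⟨ht0.trans htt'.le, ht'h⟩ (Complex.ext (by simpa using h) (by simpa using ht'im))
  have hcont : ContinuousOn (fun s => (Γ s).im) (Icc t t') := Complex.continuous_im.comp_continuousOn (hΓ.mono hsub)
  -- the end of any bad piece starting at `t` is `t'`
  have huniq : ∀ t₂, t < t₂ → t₂ ≤ 1 / 2 → (∀ s ∈ Ioo t t₂, 0 < (Γ s).im) → (Γ t₂).im = 0 → t₂ = t' := by
    intro t₂ h12 h₂ hpos him₂
    have h2Z : t₂ ∈ Z := (hmemZ t₂).2 ⟨⟨ht0.trans h12.le, h₂⟩, him₂⟩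
    have hle : t' ≤ t₂ := hmin t₂ h2Z h12
    rcases hle.lt_or_eq with hlt₂ | heq
    · exact absurd ht'im (hpos t' ⟨htt', hlt₂⟩).ne'
    · exact heq.symm
  rcases pos_or_neg_of_ne_zero hcont hgap with hpos | hneg
  · -- a BAD piece
    have hup : ∀ s ∈ Icc t t', 0 ≤ (Γ s).im := by
      intro s hs
      rcases hs.1.eq_or_lt with h1 | h1
      · rw [← h1, htim]
      · rcases hs.2.lt_or_eq with h2 | h2
        · exact (hpos s ⟨h1, h2⟩).le
        · rw [h2, ht'im]
    have e := im_incr_piece_up htt'.le (hΓ.mono hsub) (hl.mono hsub) (fun s hs => hexp s (hsub hs))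
      (fun s hs => hne s (hsub hs)) hup htim ht'im
    have hpiece : 0 ≤ t ∧ t < t' ∧ t' ≤ 1 / 2 ∧ (∀ s ∈ Ioo t t', 0 < (Γ s).im) ∧ (Γ t).im = 0 ∧ (Γ t').im = 0 :=
      ⟨ht0, htt', ht'h, hpos, htim, ht'im⟩
    have hAiff : t ∈ A ↔ (Γ t).re < 0 ∧ 0 < (Γ t').re := by
      rw [hmemA]
      constructor
      · rintro ⟨t₂, ⟨-, h12, h₂, hp, -, him₂⟩, hre, hre₂⟩
        rw [huniq t₂ h12 h₂ hp him₂] at hre₂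
        exact ⟨hre, hre₂⟩
      · rintro ⟨hre, hre'⟩
        exact ⟨t', hpiece, hre, hre'⟩
    have hDiff : t ∈ D ↔ 0 < (Γ t).re ∧ (Γ t').re < 0 := by
      rw [hmemD]
      constructor
      · rintro ⟨t₂, ⟨-, h12, h₂, hp, -, him₂⟩, hre, hre₂⟩
        rw [huniq t₂ h12 h₂ hp him₂] at hre₂
        exact ⟨hre, hre₂⟩
      · rintro ⟨hre, hre'⟩
        exact ⟨t', hpiece, hre, hre'⟩
    have hσ : ((zsgn (Γ t').re : ℝ) - (zsgn (Γ t).re : ℝ)) =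
        2 * ((if t ∈ A then (1 : ℝ) else 0) - (if t ∈ D then (1 : ℝ) else 0)) := by
      unfold zsgn
      by_cases h1 : 0 < (Γ t).re
      · by_cases h2 : 0 < (Γ t').re
        · rw [if_pos h1, if_pos h2, if_neg (fun h => (not_lt.2 (hAiff.1 h).1.le) h1), if_neg (fun h => (not_lt.2 (hDiff.1 h).2.le) h2)]
          push_cast; ring
        · rw [if_pos h1, if_neg h2, if_neg (fun h => (not_lt.2 (hAiff.1 h).1.le) h1),
            if_pos (hDiff.2 ⟨h1, lt_of_le_of_ne (not_lt.1 h2) hret'⟩)]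
          push_cast; ring
      · have h1' : (Γ t).re < 0 := lt_of_le_of_ne (not_lt.1 h1) hret
        by_cases h2 : 0 < (Γ t').re
        · rw [if_neg h1, if_pos h2, if_pos (hAiff.2 ⟨h1', h2⟩), if_neg (fun h => h1 (hDiff.1 h).1)]
          push_cast; ring
        · rw [if_neg h1, if_neg h2, if_neg (fun h => h2 (hAiff.1 h).2), if_neg (fun h => h1 (hDiff.1 h).1)]
          push_cast; ring
    rw [hstepA, hstepD]
    linear_combination IH + e - π * hσ
  · -- a GOOD piece: no piece starts at `t`
    have hdown : ∀ s ∈ Icc t t', (Γ s).im ≤ 0 := by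
      intro s hs
      rcases hs.1.eq_or_lt with h1 | h1
      · rw [← h1, htim]
      · rcases hs.2.lt_or_eq with h2 | h2
        · exact (hneg s ⟨h1, h2⟩).le
        · rw [h2, ht'im]
    have e := im_incr_piece_down htt'.le (hΓ.mono hsub) (hl.mono hsub) (fun s hs => hexp s (hsub hs))
      (fun s hs => hne s (hsub hs)) hdown htim ht'im
    have hnostart : ∀ t₂, ¬ (t < t₂ ∧ t₂ ≤ 1 / 2 ∧ (∀ s ∈ Ioo t t₂, 0 < (Γ s).im) ∧ (Γ t₂).im = 0) := by
      rintro t₂ ⟨h12, h₂, hp, him₂⟩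
      have h := huniq t₂ h12 h₂ hp him₂
      subst h
      have hm : (t + t') / 2 ∈ Ioo t t' := ⟨by linarith, by linarith⟩
      exact absurd (hp _ hm) (not_lt.2 (hneg _ hm).le)
    have htA : t ∉ A := by
      rw [hmemA]
      rintro ⟨t₂, ⟨-, h12, h₂, hp, -, him₂⟩, -, -⟩
      exact hnostart t₂ ⟨h12, h₂, hp, him₂⟩
    have htD : t ∉ D := by
      rw [hmemD]
      rintro ⟨t₂, ⟨-, h12, h₂, hp, -, him₂⟩, -, -⟩
      exact hnostart t₂ ⟨h12, h₂, hp, him₂⟩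
    rw [hstepA, hstepD, if_neg htA, if_neg htD]
    linear_combination IH + e

/-! ## §4 The exact loop identity -/

/-- On a flat upper half there are no pieces. -/
theorem ascSet_eq_empty_of_flat {Γ : ℝ → ℂ} (hflat : ∀ t ∈ Icc (0 : ℝ) (1 / 2), (Γ t).im = 0) : ascSet Γ = ∅ := by
  ext t₁
  simp only [mem_empty_iff_false, iff_false]
  rintro ⟨t₂, ⟨h₁, h12, h₂, hp, -, -⟩, -, -⟩
  have hm : (t₁ + t₂) / 2 ∈ Ioo t₁ t₂ := ⟨by linarith, by linarith⟩
  exact absurd (hflat _ ⟨by linarith, by linarith⟩) (hp _ hm).ne'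

/-- On a flat upper half there are no pieces. -/
theorem descSet_eq_empty_of_flat {Γ : ℝ → ℂ} (hflat : ∀ t ∈ Icc (0 : ℝ) (1 / 2), (Γ t).im = 0) : descSet Γ = ∅ := by
  ext t₁
  simp only [mem_empty_iff_false, iff_false]
  rintro ⟨t₂, ⟨h₁, h12, h₂, hp, -, -⟩, -, -⟩
  have hm : (t₁ + t₂) / 2 ∈ Ioo t₁ t₂ := ⟨by linarith, by linarith⟩
  exact absurd (hflat _ ⟨by linarith, by linarith⟩) (hp _ hm).ne'

/-- ★ EXACT LOOP IDENTITY.  A conjugation-symmetric zero-free loop whose upper half has finitely many real points — or is real throughout —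
satisfies `2·wind Γ = sgn Re Γ(½) − sgn Re Γ(0) + 4(#desc − #asc)`. -/
theorem two_mul_wind_eq_count {Γ : ℝ → ℂ} (hΓ : ContinuousOn Γ (Icc 0 1)) (h01 : Γ 0 = Γ 1) (hne : ∀ t ∈ Icc (0 : ℝ) 1, Γ t ≠ 0)
    (hsym : ∀ t ∈ Icc (0 : ℝ) 1, Γ (1 - t) = (starRingEnd ℂ) (Γ t))
    (hZ : {t : ℝ | t ∈ Icc (0 : ℝ) (1 / 2) ∧ (Γ t).im = 0}.Finite ∨ ∀ t ∈ Icc (0 : ℝ) (1 / 2), (Γ t).im = 0) :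
    (ascSet Γ).Finite ∧ (descSet Γ).Finite ∧
      2 * (wind Γ : ℂ) = sgn (Γ (1 / 2)).re - sgn (Γ 0).re + 4 * (((descSet Γ).ncard : ℂ) - ((ascSet Γ).ncard : ℂ)) := by
  obtain ⟨l, hl, hle⟩ := (IsNonvanishingLoop.mk hΓ hne h01).hasLogOn
  have hw := wind_spec hl hle h01
  have hq0 : (0 : ℝ) ≤ 1 / 2 := by norm_num
  have hq1 : (1 / 2 : ℝ) ≤ 1 := by norm_num
  have h0 : (Γ 0).im = 0 := by
    have e := hsym 0 ⟨le_rfl, zero_le_one⟩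
    rw [sub_zero, ← h01] at e
    exact conj_eq_iff_im.1 e.symm
  have hh : (Γ (1 / 2)).im = 0 := by
    have e := hsym (1 / 2) ⟨hq0, hq1⟩
    rw [show (1 : ℝ) - 1 / 2 = 1 / 2 by norm_num] at e
    exact conj_eq_iff_im.1 e.symm
  have hI : ∀ t ∈ Icc (0 : ℝ) 1, 1 - t ∈ Icc (0 : ℝ) 1 := fun t ht => ⟨by linarith [ht.2], by linarith [ht.1]⟩
  have hl₂ : ContinuousOn (fun t => (starRingEnd ℂ) (l (1 - t))) (Icc 0 1) := by
    refine Complex.continuous_conj.comp_continuousOn (hl.comp (continuousOn_const.sub continuousOn_id) fun t ht => hI t ht)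
  have hle₂ : ∀ t ∈ Icc (0 : ℝ) 1, exp ((starRingEnd ℂ) (l (1 - t))) = exp (l t) := by
    intro t ht
    rw [Complex.exp_conj, hle (1 - t) (hI t ht), hsym t ht, Complex.conj_conj, hle t ht]
  obtain ⟨k, hk⟩ := exists_int_eq_add_of_exp_eq isPreconnected_Icc hl₂ hl hle₂
  have hk0 := congrArg Complex.im (hk 0 ⟨le_rfl, zero_le_one⟩)
  have hkh := congrArg Complex.im (hk (1 / 2) ⟨hq0, hq1⟩)
  simp only [sub_zero, Complex.conj_im, Complex.add_im, show (1 : ℝ) - 1 / 2 = 1 / 2 by norm_num] at hk0 hkh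
  have hkI : ((k : ℂ) * (2 * π * I)).im = 2 * π * k := by simp [Complex.mul_im]; ring
  rw [hkI] at hk0 hkh
  have hsymL : (l 1).im - (l (1 / 2)).im = (l (1 / 2)).im - (l 0).im := by linarith
  have hΓ' := hΓ.mono (Icc_subset_Icc_right hq1)
  have hl' := hl.mono (Icc_subset_Icc_right hq1)
  have hle' : ∀ t ∈ Icc (0 : ℝ) (1 / 2), exp (l t) = Γ t := fun t ht => hle t ⟨ht.1, ht.2.trans hq1⟩
  have hne' : ∀ t ∈ Icc (0 : ℝ) (1 / 2), Γ t ≠ 0 := fun t ht => hne t ⟨ht.1, ht.2.trans hq1⟩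
  -- the upper half: the exact identity (finite case) or one flat piece with no pieces
  have hhalf : (ascSet Γ).Finite ∧ (descSet Γ).Finite ∧
      (l (1 / 2)).im - (l 0).im = π / 2 * ((zsgn (Γ (1 / 2)).re : ℝ) - (zsgn (Γ 0).re : ℝ)) +
        2 * π * (((descSet Γ).ncard : ℝ) - ((ascSet Γ).ncard : ℝ)) := by
    rcases hZ with hfin | hflat
    · exact im_incr_eq_count hΓ' hl' hle' hne' h0 hh hfin
    · rw [ascSet_eq_empty_of_flat hflat, descSet_eq_empty_of_flat hflat]
      refine ⟨Set.finite_empty, Set.finite_empty, ?_⟩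
      rw [im_incr_piece_down hq0 hΓ' hl' hle' hne' (fun t ht => (hflat t ht).le) h0 hh]
      simp
  obtain ⟨hAfin, hDfin, hid⟩ := hhalf
  refine ⟨hAfin, hDfin, ?_⟩
  have hwim := congrArg Complex.im hw
  have hwI : ((wind Γ : ℂ) * (2 * π * I)).im = 2 * π * (wind Γ : ℝ) := by simp [Complex.mul_im]; ring
  rw [Complex.sub_im, hwI] at hwim
  have key : π * (2 * (wind Γ : ℝ)) = π * (((zsgn (Γ (1 / 2)).re : ℝ) - (zsgn (Γ 0).re : ℝ)) +
      4 * (((descSet Γ).ncard : ℝ) - ((ascSet Γ).ncard : ℝ))) := by linarith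
  have hR := mul_left_cancel₀ Real.pi_ne_zero key
  have hZeq : 2 * wind Γ = zsgn (Γ (1 / 2)).re - zsgn (Γ 0).re + 4 * (((descSet Γ).ncard : ℤ) - ((ascSet Γ).ncard : ℤ)) := by
    exact_mod_cast hR
  rw [sgn_eq_zsgn, sgn_eq_zsgn]
  exact_mod_cast hZeq

end RhW08.Lens1ArcSign
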